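import Summits.QuantumFields.YangMills.Theses.MarginalTwistOnset

/-!
# Route `MarginalTwistOnset`, support item `SharpImpliesOnset` (stmt-QuantumFields-9803)

The glue `SharpTwistTransmutation → ExpScaleTwistOnset`: from the sharp two-sided twist transmutation at rate `κ`
take `C := 3κ` and the scale function `S₀ β := ⌈exp (2κβ)⌉₊`.  Pure logic plus `Nat.ceil` bookkeeping:
`S₀ → ∞`; eventually `⌈e^{2κβ}⌉₊ ≤ e^{2κβ} + 1 ≤ 2e^{2κβ} ≤ e^{κβ}e^{2κβ} = e^{3κβ}`; and the onset clause of the sharp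
statement at exponent tolerance `1/2` applies at `S₀ β` because `e^{(3/2)κβ} ≤ e^{2κβ} ≤ ⌈e^{2κβ}⌉₊` for `β ≥ 0`.
(The grounders' candidate proofs of 2026-08-15 describe the same argument; this file is written afresh against the tree.)

References: Q. Berger, H. Lacoin, *JIMJ* 17 (2017) [BergerLacoin2017] (the shape of the onset statement only).
-/

namespace Summit.QuantumFields.YangMills.Theorems.MarginalTwistOnsetGlue

open Filter
open Summit.QuantumFields.YangMills.Theses.MarginalTwistOnset

/-- Ceiling bookkeeping: for `κ > 0`, eventually in `β`, `⌈exp (2κβ)⌉₊ ≤ exp (3κβ)`.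
[cite: BergerLacoin2017, §1 (shape of the onset scale only)] -/
theorem eventually_ceil_exp_two_mul_le_exp_three_mul {κ : ℝ} (hκ : 0 < κ) :
    ∀ᶠ β : ℝ in atTop, ((⌈Real.exp (2 * κ * β)⌉₊ : ℕ) : ℝ) ≤ Real.exp (3 * κ * β) := by
  filter_upwards [eventually_ge_atTop (Real.log 2 / κ)] with β hβ
  have hκβ : Real.log 2 ≤ κ * β := by
    rw [div_le_iff₀ hκ] at hβ
    linarith [mul_comm β κ]
  have h2 : (2 : ℝ) ≤ Real.exp (κ * β) := by
    calc (2 : ℝ) = Real.exp (Real.log 2) := (Real.exp_log (by norm_num)).symm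
      _ ≤ Real.exp (κ * β) := Real.exp_le_exp.mpr hκβ
  have hpos : 0 ≤ Real.exp (2 * κ * β) := (Real.exp_pos _).le
  have hceil : ((⌈Real.exp (2 * κ * β)⌉₊ : ℕ) : ℝ) < Real.exp (2 * κ * β) + 1 := Nat.ceil_lt_add_one hpos
  have h1 : (1 : ℝ) ≤ Real.exp (2 * κ * β) := by
    have : 0 ≤ 2 * κ * β := by
      have : 0 ≤ κ * β := le_trans (by positivity : (0:ℝ) ≤ Real.log 2) hκβ |>.trans' (le_refl _)
      nlinarith [Real.log_nonneg (by norm_num : (1:ℝ) ≤ 2)]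
    simpa using Real.one_le_exp this
  have h3 : Real.exp (3 * κ * β) = Real.exp (κ * β) * Real.exp (2 * κ * β) := by
    rw [← Real.exp_add]; ring_nf
  calc ((⌈Real.exp (2 * κ * β)⌉₊ : ℕ) : ℝ) ≤ Real.exp (2 * κ * β) + 1 := hceil.le
    _ ≤ 2 * Real.exp (2 * κ * β) := by linarith
    _ ≤ Real.exp (κ * β) * Real.exp (2 * κ * β) := by
        exact mul_le_mul_of_nonneg_right h2 hpos
    _ = Real.exp (3 * κ * β) := h3.symm

/-- **Item stmt-QuantumFields-9803** (`SharpImpliesOnset`): the sharp two-sided twist transmutation implies the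
exponential-scale twist onset, with `C := 3κ` and `S₀ β := ⌈exp (2κβ)⌉₊`.
[cite: BergerLacoin2017, §1 (shape of the onset statement only)] -/
theorem sharpImpliesOnset_proof : SharpImpliesOnset := by
  intro hSharp G _ _ _ _ hG r Z hZ
  obtain ⟨κ, hκ, hev⟩ := hSharp G hG r Z hZ
  refine ⟨3 * κ, by positivity, fun β => ⌈Real.exp (2 * κ * β)⌉₊, ?_, ?_, ?_⟩
  · -- `S₀ → ∞`
    refine tendsto_nat_ceil_atTop.comp ?_
    refine Real.tendsto_exp_atTop.comp ?_
    exact Tendsto.const_mul_atTop (by positivity) tendsto_id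
  · -- eventually `S₀ β ≤ exp (3κβ)`
    exact eventually_ceil_exp_two_mul_le_exp_three_mul hκ
  · -- the onset clause at tolerance `1/2`
    intro ε hε
    have h := hev (1 / 2) ε (by norm_num) hε
    filter_upwards [h, eventually_ge_atTop (0 : ℝ)] with β hβ hβ0 z hz q
    refine (hβ.2) _ ?_ z hz q
    have hle : Real.exp ((1 + 1 / 2) * κ * β) ≤ Real.exp (2 * κ * β) := by
      apply Real.exp_le_exp.mpr
      have : 0 ≤ κ * β := mul_nonneg hκ.le hβ0
      nlinarith
    exact hle.trans (Nat.le_ceil _)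

end Summit.QuantumFields.YangMills.Theorems.MarginalTwistOnsetGlue
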